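import Summits.HubbardSuperconductivity.HubbardSuperconductivity.Theses.FluxSpectroscopy
import Literature.MathematicalPhysics.QuantumLattice.HubbardTorusFlux
import Literature.MathematicalPhysics.QuantumLattice.HubbardRingPerronFrobeniusProofs
import Literature.MathematicalPhysics.QuantumLattice.SectorSpectrum
import HarnessLib

/-!
# Stub `stub_uniformYangUpgrade` of line `registered` (reshape r1)
# (crux `IncommensurateRigidity`, item stmt-HubbardSuperconductivity-2195, route ParityGapRigidity)

**What.** The glue stub G of the r1 skeleton
`Cruxes/IncommensurateRigidity/Lines/birth.lean` of the crux
`Summit.HubbardSuperconductivity.HubbardSuperconductivity.Theses.ParityGapRigidity.IncommensurateRigidity`: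
the programme's flux bridge `FluxSpectroscopy.FluxBridge` (item stmt-HubbardSuperconductivity-1817,
a HYPOTHESIS here) is stated per ADMISSIBLE SEQUENCE of normalised `(N_L, S^z = 0)`-sector ground
states `ψ L` of `hubbardTorus 2 L 1 U` (`N_L = 2⌊(1-δ)L²/2⌋`), with a sequence-dependent constant
`c > 0` and in eigenpair form (`ρ₂(ψ L) v = ev • v`, `ev ≥ c N_L`, eventually in even `L`). Under the
flux criterion `FC_T(U, δ)` it implies the crux's UNIFORM conclusion: one `a > 0` such that for all
large even `L` EVERY normalised sector ground state `ψ` has a unit pair wavefunction `v` with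
`a L² ≤ Re v† ρ₂(ψ) v`.

**Proof (diagonal argument).** Suppose not. Call a side `L` `a`-bad if some normalised sector ground
state at side `L` has `Re v† ρ₂ v < a L²` for every unit `v`; the negation says that for every `a > 0`
there are arbitrarily large even `a`-bad sides. Normalised sector ground states exist at every side
(`szSector_groundState` with `n = ⌊(1-δ)L²/2⌋ ≤ L² = |Λ|`, normalised by `exists_smul_unit`). Define the
diagonal sequence: at side `L` let `k⋆(L)` be the largest `k ≤ L` such that `L` is `1/(k+1)`-bad
(`Nat.findGreatest`), and let `Ψ L` be a witness of `1/(k⋆(L)+1)`-badness if `L` is `1/(k⋆(L)+1)`-bad,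
and an arbitrary normalised sector ground state otherwise. `FluxBridge` applied to `Ψ` yields `c > 0`
and `L⋆` with an eigenpair `(v, ev)`, `ev ≥ c N_L`, at every even `L ≥ L⋆`. Choose `k` with
`1/(k+1) < c/4` and an even `1/(k+1)`-bad side `L ≥ max k L⋆ ⊔ 3`; then `k ≤ k⋆(L)` and `L` is
`1/(k⋆(L)+1)`-bad, so `Ψ L` is a badness witness: `ev = Re v† ρ₂(Ψ L) v < L²/(k⋆(L)+1) ≤ L²/(k+1) <
c L²/4`, while `ev ≥ c N_L > c (L²/2 - 2)` (`δ < 1/2`). Hence `L² < 8`, contradicting `L ≥ 3`.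

**Registered form.** The stub is registered on the item (skeleton r1, re-registration of
2026-08-17T09:22Z) under the fully unfolded signature below — the skeleton-local
`def UniformYangUpgrade` with `FluxCriterion` / `YangODLRO` unfolded — and is proved here under its
registered name `stub_uniformYangUpgrade`, so it discharges the skeleton's `sorry` as it stands.

Log: v1 written from the lead's plan (playbook: none fit; pattern of
`exists_unit_isGroundStateInSector_plaquette` / `HubbardPairDensityCouplingFloor` for normalisation);
`lean check` rc 0 / sorries 0 at v1, then `push_neg` ↦ `push Not` (deprecation warning); p150599
BOUNCED `supports.stub-mismatch` (the stub was then registered as the bare name `UniformYangUpgrade`);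
a v2 with a local `def UniformYangUpgrade` copy would have been review-queued (D-0009, new def in
`Theorems/`); the lead re-registered the stub with the unfolded signature, so v3 = v1's header again.
-/

noncomputable section

namespace Summit.HubbardSuperconductivity.IncommensurateRigidity.Birth

open Literature.MathematicalPhysics.QuantumLattice Matrix Filter
open scoped BigOperators ComplexOrder

/-! ### Normalised sector ground states exist at every side -/

/-- For `n ≤ L²` the `(2n, S^z = 0)` sector of the Hubbard torus `hubbardTorus 2 L 1 U` has a
NORMALISED ground state (`szSector_groundState` on `fermionTorusGraph 2 L`, `|Λ| = L²`, then
`exists_smul_unit`; `IsGroundStateInSector` is stable under nonzero scalars). -/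
theorem exists_unit_isGroundStateInSector_torus (L : ℕ) (U : ℝ) {n : ℕ} (hn : n ≤ L ^ 2) :
    ∃ φ : Fock (Orb (FermionTorus 2 L)), star φ ⬝ᵥ φ = 1 ∧
      IsGroundStateInSector (hubbardTorus 2 L 1 U) (2 * n) 0 φ := by
  have hn' : n ≤ Fintype.card (FermionTorus 2 L) := by simpa using hn
  obtain ⟨⟨φ₀, hφ₀S, hφ₀0, hHφ₀⟩, -⟩ := szSector_groundState (fermionTorusGraph 2 L) 1 U hn'
  obtain ⟨a, ha, hφ1⟩ := exists_smul_unit hφ₀0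
  refine ⟨a • φ₀, hφ1, Submodule.smul_mem _ _ hφ₀S, smul_ne_zero ha hφ₀0, ?_⟩
  rw [mulVec_smul, smul_comm]
  exact congrArg (a • ·) hHφ₀

/-- The filling numerator is at most the volume: `⌊(1-δ)L²/2⌋ ≤ L²` for `0 ≤ δ`. -/
theorem floor_filling_le (L : ℕ) {δ : ℝ} (hδ : 0 ≤ δ) : ⌊(1 - δ) * (L : ℝ) ^ 2 / 2⌋₊ ≤ L ^ 2 := by
  refine Nat.floor_le_of_le ?_
  push_cast
  nlinarith [sq_nonneg (L : ℝ)]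

/-- Normalised `(N_L, 0)`-sector ground states of `hubbardTorus 2 L 1 U`, `N_L = 2⌊(1-δ)L²/2⌋`, exist at
every side `L` (for `0 ≤ δ`). -/
theorem exists_unit_isGroundStateInSector_filling (L : ℕ) (U : ℝ) {δ : ℝ} (hδ : 0 ≤ δ) :
    ∃ φ : Fock (Orb (FermionTorus 2 L)), star φ ⬝ᵥ φ = 1 ∧
      IsGroundStateInSector (hubbardTorus 2 L 1 U) (2 * ⌊(1 - δ) * (L : ℝ) ^ 2 / 2⌋₊) 0 φ :=
  exists_unit_isGroundStateInSector_torus L U (floor_filling_le L hδ)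

/-- Density floor: `L²/2 - 2 < N_L = 2⌊(1-δ)L²/2⌋` for `δ ≤ 1/2`. -/
theorem filling_gt (L : ℕ) {δ : ℝ} (hδ : δ ≤ 1 / 2) :
    (L : ℝ) ^ 2 / 2 - 2 < ((2 * ⌊(1 - δ) * (L : ℝ) ^ 2 / 2⌋₊ : ℕ) : ℝ) := by
  have h1 := Nat.lt_floor_add_one ((1 - δ) * (L : ℝ) ^ 2 / 2)
  have h2 : 0 ≤ (1 / 2 - δ) * (L : ℝ) ^ 2 := mul_nonneg (by linarith) (sq_nonneg _)
  push_cast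
  nlinarith [h1, h2]

/-- The Rayleigh quotient of a unit eigenvector is its eigenvalue:
`Re v† (M v) = ev` if `M v = ev • v` and `v† v = 1`. -/
theorem re_rayleigh_of_eigen {κ : Type*} [Fintype κ] (M : Matrix κ κ ℂ) (v : κ → ℂ) (ev : ℝ)
    (hv : star v ⬝ᵥ v = 1) (h : M *ᵥ v = (ev : ℂ) • v) : (star v ⬝ᵥ (M *ᵥ v)).re = ev := by
  rw [h, dotProduct_smul, smul_eq_mul, hv, mul_one, Complex.ofReal_re]

/-! ### The stub -/

/-- **Stub G `stub_uniformYangUpgrade`** (uniform Yang upgrade; glue of the r1 skeleton of crux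
`IncommensurateRigidity`, registered signature = the skeleton's `UniformYangUpgrade` unfolded): the
sequence-wise flux bridge `FluxSpectroscopy.FluxBridge` (stmt-1817, hypothesis) implies, for every
`U > 0`, `δ ∈ (0, 1/2)` and under the flux criterion `FC_T(U, δ)` (stiffness
`ρ θ² ≤ E^T_L(θ) - E^T_L(0)` of the flux envelope `fluxEnergy` up to `|θ| ≤ π/2`, eventually in even
`L`), the crux's UNIFORM Yang ODLRO: one `a > 0` such that for all large even `L` every normalised
`(N_L, 0)`-sector ground state `ψ` of `hubbardTorus 2 L 1 U` admits a unit pair wavefunction `v` with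
`a L² ≤ Re v† ρ₂(ψ) v`. Diagonal argument (module docstring): a sequence of ever-worse ground states
along even sides, completed by arbitrary normalised sector ground states, would contradict the
eventual eigenvalue floor `ev ≥ c N_L > c (L²/2 - 2)` of `FluxBridge`. -/
theorem stub_uniformYangUpgrade :
    Summit.HubbardSuperconductivity.HubbardSuperconductivity.Theses.FluxSpectroscopy.FluxBridge →
    ∀ (U δ : ℝ), 0 < U → δ ∈ Set.Ioo (0 : ℝ) (1 / 2) →
      (∃ ρ : ℝ, 0 < ρ ∧ ∀ᶠ L : ℕ in atTop, ∀ [NeZero L], Even L → ∀ θ : ℝ, |θ| ≤ Real.pi / 2 →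
          ρ * θ ^ 2 ≤ fluxEnergy L U δ θ - fluxEnergy L U δ 0) →
      ∃ a : ℝ, 0 < a ∧ ∃ L₁ : ℕ, ∀ L ≥ L₁, Even L → ∀ Hm, Hm = hubbardTorus 2 L 1 U → ∀ ψ,
        IsGroundStateInSector Hm (2 * ⌊(1 - δ) * (L : ℝ) ^ 2 / 2⌋₊) 0 ψ → star ψ ⬝ᵥ ψ = 1 →
        ∃ v : Orb (FermionTorus 2 L) × Orb (FermionTorus 2 L) → ℂ,
          star v ⬝ᵥ v = 1 ∧ a * (L : ℝ) ^ 2 ≤ (star v ⬝ᵥ Matrix.mulVec (twoParticleRDM ψ) v).re := by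
  intro hFB U δ hU hδ hFC
  classical
  -- `FluxBridge` at `(U, δ)` under `FC_T(U, δ)`: every admissible sequence has a macroscopic eigenpair
  have hFB' : ∀ (N : ℕ → ℕ) (ψ : ∀ L : ℕ, Fock (Orb (FermionTorus 2 L))),
      (∀ L, Even L → N L = 2 * ⌊(1 - δ) * (L : ℝ) ^ 2 / 2⌋₊ ∧ star (ψ L) ⬝ᵥ ψ L = 1 ∧
        IsGroundStateInSector (hubbardTorus 2 L 1 U) (N L) 0 (ψ L)) →
      ∃ c : ℝ, 0 < c ∧ ∀ᶠ L : ℕ in atTop, ∀ [NeZero L], Even L →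
        ∃ v : Orb (FermionTorus 2 L) × Orb (FermionTorus 2 L) → ℂ, ∃ ev : ℝ,
          star v ⬝ᵥ v = 1 ∧ Matrix.mulVec (twoParticleRDM (ψ L)) v = (ev : ℂ) • v ∧
            c * (N L : ℝ) ≤ ev :=
    fun N ψ hHyp => hFB U δ hU hδ hFC N ψ hHyp
  clear hFB hFC
  by_contra hneg
  -- badness of a side `L` at level `a`: a normalised sector ground state with all Rayleigh quotients `< a L²`
  let Bad : ℝ → ℕ → Prop := fun a L => ∃ ψ : Fock (Orb (FermionTorus 2 L)),
    IsGroundStateInSector (hubbardTorus 2 L 1 U) (2 * ⌊(1 - δ) * (L : ℝ) ^ 2 / 2⌋₊) 0 ψ ∧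
      star ψ ⬝ᵥ ψ = 1 ∧ ∀ v : Orb (FermionTorus 2 L) × Orb (FermionTorus 2 L) → ℂ,
        star v ⬝ᵥ v = 1 → (star v ⬝ᵥ (twoParticleRDM ψ *ᵥ v)).re < a * (L : ℝ) ^ 2
  -- the negation of the conclusion: arbitrarily large even bad sides at every level `a > 0`
  have hbad : ∀ a : ℝ, 0 < a → ∀ L₁ : ℕ, ∃ L, L₁ ≤ L ∧ Even L ∧ Bad a L := by
    intro a ha L₁
    by_contra hcon
    push Not at hcon
    refine hneg ⟨a, ha, L₁, fun L hL hE Hm hHm ψ hψ h1 => ?_⟩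
    subst hHm
    by_contra hv
    push Not at hv
    exact hcon L hL hE ⟨ψ, hψ, h1, hv⟩
  -- the diagonal sequence
  let kstar : ℕ → ℕ := fun L => Nat.findGreatest (fun k => Bad (1 / ((k : ℝ) + 1)) L) L
  have hΨex : ∀ L, ∃ ψ : Fock (Orb (FermionTorus 2 L)),
      IsGroundStateInSector (hubbardTorus 2 L 1 U) (2 * ⌊(1 - δ) * (L : ℝ) ^ 2 / 2⌋₊) 0 ψ ∧
        star ψ ⬝ᵥ ψ = 1 ∧ (Bad (1 / ((kstar L : ℝ) + 1)) L →
          ∀ v : Orb (FermionTorus 2 L) × Orb (FermionTorus 2 L) → ℂ, star v ⬝ᵥ v = 1 →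
            (star v ⬝ᵥ (twoParticleRDM ψ *ᵥ v)).re < 1 / ((kstar L : ℝ) + 1) * (L : ℝ) ^ 2) := by
    intro L
    by_cases h : Bad (1 / ((kstar L : ℝ) + 1)) L
    · obtain ⟨ψ, hψ, h1, hv⟩ := h
      exact ⟨ψ, hψ, h1, fun _ => hv⟩
    · obtain ⟨φ, h1, hφ⟩ := exists_unit_isGroundStateInSector_filling L U hδ.1.le
      exact ⟨φ, hφ, h1, fun hb => absurd hb h⟩
  choose Ψ hΨgs hΨ1 hΨbad using hΨex
  -- apply the flux bridge to the diagonal sequence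
  obtain ⟨c, hc, hev⟩ :=
    hFB' (fun L => 2 * ⌊(1 - δ) * (L : ℝ) ^ 2 / 2⌋₊) Ψ fun L _ => ⟨rfl, hΨ1 L, hΨgs L⟩
  obtain ⟨Lstar, hLstar⟩ := eventually_atTop.1 hev
  obtain ⟨k, hk⟩ := exists_nat_one_div_lt (by positivity : (0 : ℝ) < c / 4)
  obtain ⟨L, hL, hE, hBadL⟩ := hbad (1 / ((k : ℝ) + 1)) (by positivity) (max (max k Lstar) 3)
  have hkL : k ≤ L := le_trans (le_trans (le_max_left _ _) (le_max_left _ _)) hL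
  have hLs : Lstar ≤ L := le_trans (le_trans (le_max_right _ _) (le_max_left _ _)) hL
  have h3 : 3 ≤ L := le_trans (le_max_right _ _) hL
  -- `Ψ L` is a badness witness at level `1/(k⋆(L)+1) ≤ 1/(k+1)`
  have hk_le : k ≤ kstar L :=
    Nat.le_findGreatest (P := fun k => Bad (1 / ((k : ℝ) + 1)) L) hkL hBadL
  have hBadK : Bad (1 / ((kstar L : ℝ) + 1)) L :=
    Nat.findGreatest_spec (P := fun k => Bad (1 / ((k : ℝ) + 1)) L) hkL hBadL
  -- the flux bridge's eigenpair at side `L`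
  haveI : NeZero L := ⟨by omega⟩
  obtain ⟨v, ev, hv1, hveig, hcN⟩ := hLstar L hLs hE
  have hray : (star v ⬝ᵥ (twoParticleRDM (Ψ L) *ᵥ v)).re = ev :=
    re_rayleigh_of_eigen _ v ev hv1 hveig
  have hlt := hΨbad L hBadK v hv1
  rw [hray] at hlt
  have hmono : 1 / ((kstar L : ℝ) + 1) ≤ 1 / ((k : ℝ) + 1) :=
    one_div_le_one_div_of_le (by positivity) (by exact_mod_cast Nat.succ_le_succ hk_le)
  have hN := filling_gt L hδ.2.le
  have hL3 : (3 : ℝ) ≤ L := by exact_mod_cast h3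
  have hL9 : c * 9 ≤ c * (L : ℝ) ^ 2 := mul_le_mul_of_nonneg_left (by nlinarith) hc.le
  have h1' : c * ((L : ℝ) ^ 2 / 2 - 2) < ev := lt_of_lt_of_le (mul_lt_mul_of_pos_left hN hc) hcN
  have h2' : ev < c / 4 * (L : ℝ) ^ 2 :=
    calc ev < 1 / ((kstar L : ℝ) + 1) * (L : ℝ) ^ 2 := hlt
      _ ≤ 1 / ((k : ℝ) + 1) * (L : ℝ) ^ 2 := mul_le_mul_of_nonneg_right hmono (by positivity)
      _ < c / 4 * (L : ℝ) ^ 2 := mul_lt_mul_of_pos_right hk (by positivity)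
  linarith

end Summit.HubbardSuperconductivity.IncommensurateRigidity.Birth

end
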